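import Summits.QuantumFields.YangMills.Theorems.ScalingWindowSplitSelfNormalisedSkewnessStubTorusGreenThirdDiffProduct
import Summits.QuantumFields.YangMills.Theorems.ScalingWindowSplitSelfNormalisedSkewnessStubTorusGreenThirdDiffOneDim
import Summits.QuantumFields.YangMills.Theorems.UnitScaleTiltProp7TorusGreenGradientBricks
import HarnessLib

/-!
# Route `UnitScaleTilt`, crux K1 «MinimiserStabilityRegPr» (stmt-QuantumFields-19200), route-R E′ path (α′), residue (hK), fork (A3), row (R3) — THE HEAT-KERNEL CALCULUS KIT
# below the Fourier representation of the `Δ⁻²`-kernel `G̃₂`: the `d = 3` THIRD-DIFFERENCE bound on the product heat kernel of `(ℤ/Lℤ)³` and the two `s`-WEIGHTED time integrals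

Cell `ym3-torus`, WIDTH COPY «width 9» of `ym3-torus-p1` (seat `ym3-torus-px9` gen 2); row named by ★`ym-routeR-w3` g5 2026-08-28 19:28:35Z («(R3) `G̃₂` second∕third
differences … product bounds = Hess3∕third-difference siblings with the extra factor `s`: `∫ s·(1∨s)^{−5∕2}(…)⁻³ ≍ M⁻¹`, `∫ s·(1∨s)⁻³(…)⁻³ ≍ M⁻²`»), holder ★`ym-ust-19200-w8` g7.
THEOREMS ONLY (0 `def`, 0 `sorry`); `--supports stmt-QuantumFields-19200`, count-neutral.  YM₃ on T³ is a ladder rung (R3), not the Clay problem; nothing here claims the stub,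
the crux, d = 4 or the mass gap.

WHAT IS PROVED (ns `…Theorems.Prop7TorusHeatKernelThirdDiffThree`).
* §1 `abs_hessian_prodKernel_le_fin` — the `d`-GENERIC form of ✓ `SelfNormalisedSkewness.Negative.abs_hessian_prodKernel_le` (`d = 4`): if every coordinate kernel `Q_μ`
  obeys `|Q_μ| ≤ a_μσW`, `|∇^±Q_μ| ≤ a_μσ²W`, `|∇⁺∇⁻Q_μ| ≤ a_μσ³W` with a weight `0 ≤ W ≤ 1`, then `|∇ᵢ⁺∇ⱼ⁻[∏_μ Q_μ(·_μ)](z)| ≤ (∏_μ a_μ)·σ^{d+2}·W(z_{μ₀})` on `(ℤ/Lℤ)^d`;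
  ★★ `abs_thirdDiff_hessian_prod_torusHeatKernel_le_three` — in `d = 3`, for `0 < s ≤ L²` and every coordinate `μ₀`:
  `|∇ᵢ⁺∇ⱼ⁻[∏_μ q^L_s](z) − ∇ᵢ⁺∇ⱼ⁻[∏_μ q^L_s](z − e_k)| ≤ K·(((1∨s) + z̃_{μ₀}²)³)⁻¹` — three one-dimensional factors `(1∨s)^{−1∕2}` each and three differences
  `(1∨s)^{−1∕2}` each make `(1∨s)⁻³`, and `(1∨s)⁻³·(1 + z̃²∕(1∨s))⁻³ = ((1∨s) + z̃²)⁻³` (the two odd half-powers pair up: no square root survives, unlike the Hessian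
  sibling ✓ `Prop7TorusGreenHessianDecay.abs_hessian_prod_torusHeatKernel_le_three`).
* §2 the `s`-weighted time integrals of the `G̃₂` representation `1∕ε² = ∫₀^∞ s·e^{−sε} ds`: `mul_inv_cube_le_inv_sq` + ★ `integral_mul_inv_cube_le`
  (`∫₀^S s·(((1∨s) + M²)³)⁻¹ ds ≤ (M²)⁻¹`, via ✓ `integral_inv_add_sq_le`) and `mul_sqrt_mul_inv_cube_le_rpow` + `integral_rpow_neg_three_halves_le` +
  ★ `integral_mul_sqrt_mul_inv_cube_le` (`∫₀^S s·√(1∨s)·(((1∨s) + M²)³)⁻¹ ds ≤ 2∕M`, pointwise `s√T ≤ (T+M²)^{3∕2}` and `∫₀^∞ (s+M²)^{−3∕2} ds = 2∕M`; the cruder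
  bound `√T·(T+M²)⁻³ ≤ (2M)⁻¹(T+M²)⁻²` of the Hessian file would give a logarithm here).
HONEST SCOPE.  Folklore heat-kernel calculus (cf. Lawler–Limic 2010, §2.3, §4.3, §6.3); no Literature fact is used or restated; the Fourier representation of `G̃₂`
and its tails are (R3)'s, not here.

References: G. F. Lawler, V. Limic, *Random Walk: A Modern Introduction*, CUP 2010 [LawlerLimic2010], Thm 4.3.1, §6.3; T. Bałaban, CMP 95 (1984) 17–40
[Balaban1984PropagatorsI] (Sect. C, (1.29) p.23 — where such kernel bounds are consumed).
-/

set_option autoImplicit false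

noncomputable section

open MeasureTheory Set Finset ZMod intervalIntegral
open scoped Real BigOperators

namespace Summit.QuantumFields.YangMills.Theorems.Prop7TorusHeatKernelThirdDiffThree

open Literature.Probability.LatticeModels
open Summit.QuantumFields.YangMills.Theorems.SelfNormalisedSkewness.Negative
open Summit.QuantumFields.YangMills.Theorems.Prop7TorusGreenGradientBricks (prod_le_apply_of_le_one' integral_inv_add_sq_le)

variable {d L : ℕ}

/-! ## §1 The third difference of the product heat kernel in `d = 3` -/

/-- Splitting a product over `Fin d` at two distinct indices. [folklore] -/
theorem prod_eq_mul_mul_prod_erase_erase {i j : Fin d} (hij : i ≠ j) (f : Fin d → ℝ) :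
    ∏ μ, f μ = f i * f j * ∏ μ ∈ ((univ : Finset (Fin d)).erase i).erase j, f μ := by
  rw [mul_assoc, Finset.mul_prod_erase _ _ (Finset.mem_erase.2 ⟨hij.symm, Finset.mem_univ j⟩),
    Finset.mul_prod_erase _ _ (Finset.mem_univ i)]

/-- **Hessian of a product of coordinate kernels on `(ℤ/Lℤ)^d` under one-dimensional bounds** (the `d`-generic form of the `d = 4` lemma
✓ `SelfNormalisedSkewness.Negative.abs_hessian_prodKernel_le`): if every coordinate kernel `Q_μ` satisfies `|Q_μ| ≤ a_μ σ W`, `|∇^±Q_μ| ≤ a_μ σ² W`,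
`|∇⁺∇⁻Q_μ| ≤ a_μ σ³ W` with a weight `0 ≤ W ≤ 1`, then for every coordinate `μ₀`, `|∇ᵢ⁺∇ⱼ⁻[∏_μ Q_μ(·_μ)](z)| ≤ (∏_μ a_μ)·σ^{d+2}·W(z_{μ₀})`: the two differences fall
on one or two coordinates, and all weights but the one at `μ₀` are discarded. [folklore] -/
theorem abs_hessian_prodKernel_le_fin (Q : Fin d → ZMod L → ℝ) (a : Fin d → ℝ) (σ : ℝ)
    (W : ZMod L → ℝ) (ha : ∀ μ, 0 ≤ a μ) (hσ : 0 ≤ σ) (hW0 : ∀ m, 0 ≤ W m) (hW1 : ∀ m, W m ≤ 1)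
    (h0 : ∀ μ m, |Q μ m| ≤ a μ * σ * W m)
    (h1 : ∀ μ m, |Q μ (m + 1) - Q μ m| ≤ a μ * σ ^ 2 * W m)
    (h2 : ∀ μ m, |Q μ m - Q μ (m - 1)| ≤ a μ * σ ^ 2 * W m)
    (h3 : ∀ μ m, |Q μ (m + 1) - 2 * Q μ m + Q μ (m - 1)| ≤ a μ * σ ^ 3 * W m)
    (z : TorusSite d L) (i j μ₀ : Fin d) :
    |(∏ μ, Q μ ((z + Pi.single i 1 : TorusSite d L) μ)) -
        (∏ μ, Q μ ((z + Pi.single i 1 - Pi.single j 1 : TorusSite d L) μ)) -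
        (∏ μ, Q μ (z μ)) + ∏ μ, Q μ ((z - Pi.single j 1 : TorusSite d L) μ)| ≤
      (∏ μ, a μ) * σ ^ (d + 2) * W (z μ₀) := by
  have hWμ₀ : ∏ μ, W (z μ) ≤ W (z μ₀) :=
    prod_le_apply_of_le_one' (W := fun μ => W (z μ)) (fun μ => hW0 _) (fun μ => hW1 _) μ₀
  have hpa : 0 ≤ ∏ μ, a μ := Finset.prod_nonneg fun μ _ => ha μ
  have hd1 : 1 ≤ d := Fin.pos i
  rcases eq_or_ne i j with rfl | hij
  · rw [hessian_prodKernel_of_eq Q z i, abs_mul, Finset.abs_prod]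
    obtain ⟨n, rfl⟩ : ∃ n, d = n + 1 := ⟨d - 1, by omega⟩
    have hcard : ((univ : Finset (Fin (n + 1))).erase i).card = n := by
      rw [Finset.card_erase_of_mem (Finset.mem_univ i), Finset.card_univ, Fintype.card_fin]
      omega
    have hrest : ∏ μ ∈ (univ : Finset (Fin (n + 1))).erase i, |Q μ (z μ)| ≤
        ∏ μ ∈ (univ : Finset (Fin (n + 1))).erase i, (a μ * σ * W (z μ)) :=
      Finset.prod_le_prod (fun μ _ => abs_nonneg _) fun μ _ => h0 μ (z μ)
    have hai := ha i
    have hWi := hW0 (z i)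
    calc |Q i (z i + 1) - 2 * Q i (z i) + Q i (z i - 1)| *
          ∏ μ ∈ (univ : Finset (Fin (n + 1))).erase i, |Q μ (z μ)|
        ≤ (a i * σ ^ 3 * W (z i)) * ∏ μ ∈ (univ : Finset (Fin (n + 1))).erase i, (a μ * σ * W (z μ)) :=
          mul_le_mul (h3 i (z i)) hrest (Finset.prod_nonneg fun μ _ => abs_nonneg _) (by positivity)
      _ = (a i * ∏ μ ∈ (univ : Finset (Fin (n + 1))).erase i, a μ) * σ ^ (n + 1 + 2) *
            (W (z i) * ∏ μ ∈ (univ : Finset (Fin (n + 1))).erase i, W (z μ)) := by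
          rw [Finset.prod_mul_distrib, Finset.prod_mul_distrib, Finset.prod_const, hcard]
          ring
      _ = (∏ μ, a μ) * σ ^ (n + 1 + 2) * ∏ μ, W (z μ) := by
          rw [Finset.mul_prod_erase _ a (Finset.mem_univ i),
            Finset.mul_prod_erase _ (fun μ => W (z μ)) (Finset.mem_univ i)]
      _ ≤ (∏ μ, a μ) * σ ^ (n + 1 + 2) * W (z μ₀) := by gcongr
  · rw [hessian_prodKernel_of_ne Q z hij, abs_mul, abs_mul, Finset.abs_prod]
    have hd2 : 2 ≤ d := by
      have h := Finset.one_lt_card.2 ⟨i, Finset.mem_univ _, j, Finset.mem_univ _, hij⟩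
      rwa [Finset.card_univ, Fintype.card_fin] at h
    obtain ⟨n, rfl⟩ : ∃ n, d = n + 2 := ⟨d - 2, by omega⟩
    have hcard : (((univ : Finset (Fin (n + 2))).erase i).erase j).card = n := by
      rw [Finset.card_erase_of_mem (Finset.mem_erase.2 ⟨hij.symm, Finset.mem_univ j⟩),
        Finset.card_erase_of_mem (Finset.mem_univ i), Finset.card_univ, Fintype.card_fin]
      omega
    have hrest : ∏ μ ∈ ((univ : Finset (Fin (n + 2))).erase i).erase j, |Q μ (z μ)| ≤
        ∏ μ ∈ ((univ : Finset (Fin (n + 2))).erase i).erase j, (a μ * σ * W (z μ)) :=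
      Finset.prod_le_prod (fun μ _ => abs_nonneg _) fun μ _ => h0 μ (z μ)
    have hai := ha i
    have hWi := hW0 (z i)
    have haj := ha j
    have hWj := hW0 (z j)
    calc |Q i (z i + 1) - Q i (z i)| * |Q j (z j) - Q j (z j - 1)| *
          ∏ μ ∈ ((univ : Finset (Fin (n + 2))).erase i).erase j, |Q μ (z μ)|
        ≤ (a i * σ ^ 2 * W (z i)) * (a j * σ ^ 2 * W (z j)) *
            ∏ μ ∈ ((univ : Finset (Fin (n + 2))).erase i).erase j, (a μ * σ * W (z μ)) :=
          mul_le_mul (mul_le_mul (h1 i (z i)) (h2 j (z j)) (abs_nonneg _) (by positivity)) hrest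
            (Finset.prod_nonneg fun μ _ => abs_nonneg _) (by positivity)
      _ = (a i * a j * ∏ μ ∈ ((univ : Finset (Fin (n + 2))).erase i).erase j, a μ) * σ ^ (n + 2 + 2) *
            (W (z i) * W (z j) * ∏ μ ∈ ((univ : Finset (Fin (n + 2))).erase i).erase j, W (z μ)) := by
          rw [Finset.prod_mul_distrib, Finset.prod_mul_distrib, Finset.prod_const, hcard]
          ring
      _ = (∏ μ, a μ) * σ ^ (n + 2 + 2) * ∏ μ, W (z μ) := by
          rw [← prod_eq_mul_mul_prod_erase_erase hij a,
            ← prod_eq_mul_mul_prod_erase_erase hij (fun μ => W (z μ))]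
      _ ≤ (∏ μ, a μ) * σ ^ (n + 2 + 2) * W (z μ₀) := by gcongr


/-- ★★ **THIRD DIFFERENCE OF THE PRODUCT HEAT KERNEL OF `(ℤ/Lℤ)³`.** There is `K > 0` such that for all `L ≥ 1`, `0 < s ≤ L²`, `z ∈ (ℤ/Lℤ)³`, all `i, j, k`
and every coordinate `μ₀`,  `|∇ᵢ⁺∇ⱼ⁻[∏_μ q^L_s](z) − ∇ᵢ⁺∇ⱼ⁻[∏_μ q^L_s](z − e_k)| ≤ K·(((1∨s) + z̃_{μ₀}²)³)⁻¹`  (`z̃ = valMinAbs`): the `d = 3` sibling of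
✓ `SelfNormalisedSkewness.Negative.abs_thirdDiff_hessian_prod_torusHeatKernel_le` (`d = 4`, bound `K(1∨s)^{−1∕2}(…)⁻³`).  Three one-dimensional factors contribute
`(1∨s)^{−1∕2}` each and the three differences one more `(1∨s)^{−1∕2}` each, total `(1∨s)⁻³`; every factor carries a Gaussian weight `(1 + z̃_μ²∕(1∨s))⁻³ ≤ 1`, of
which the one at `μ₀` is kept, and `(1∨s)⁻³(1 + z̃²∕(1∨s))⁻³ = ((1∨s) + z̃²)⁻³`. [folklore] [cite: LawlerLimic2010, §6.3] -/
theorem abs_thirdDiff_hessian_prod_torusHeatKernel_le_three : ∃ K : ℝ, 0 < K ∧ ∀ (L : ℕ) [NeZero L]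
    (s : ℝ), 0 < s → s ≤ (L : ℝ) ^ 2 → ∀ (z : TorusSite 3 L) (i j k μ₀ : Fin 3),
      |((∏ μ, torusHeatKernel s ((z + Pi.single i 1 : TorusSite 3 L) μ)) -
          (∏ μ, torusHeatKernel s ((z + Pi.single i 1 - Pi.single j 1 : TorusSite 3 L) μ)) -
          (∏ μ, torusHeatKernel s (z μ)) +
          ∏ μ, torusHeatKernel s ((z - Pi.single j 1 : TorusSite 3 L) μ)) -
        ((∏ μ, torusHeatKernel s ((z - Pi.single k 1 + Pi.single i 1 : TorusSite 3 L) μ)) -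
          (∏ μ, torusHeatKernel s
            ((z - Pi.single k 1 + Pi.single i 1 - Pi.single j 1 : TorusSite 3 L) μ)) -
          (∏ μ, torusHeatKernel s ((z - Pi.single k 1 : TorusSite 3 L) μ)) +
          ∏ μ, torusHeatKernel s ((z - Pi.single k 1 - Pi.single j 1 : TorusSite 3 L) μ))| ≤
        K * ((max 1 s + ((z μ₀).valMinAbs : ℝ) ^ 2) ^ 3)⁻¹ := by
  obtain ⟨K₀, hK₀, h₀⟩ := abs_torusHeatKernel_le
  obtain ⟨K₁, hK₁, h₁⟩ := abs_torusHeatKernel_fwdDiff_le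
  obtain ⟨K₂, hK₂, h₂⟩ := abs_torusHeatKernel_bwdDiff_le
  obtain ⟨K₃, hK₃, h₃⟩ := abs_torusHeatKernel_sndDiff_le
  obtain ⟨K₄, hK₄, h₄⟩ := abs_torusHeatKernel_sndDiff_shift_le
  obtain ⟨K₅, hK₅, h₅⟩ := abs_torusHeatKernel_thirdDiff_le
  set K : ℝ := max (max (max K₀ K₁) (max K₂ K₃)) (max K₄ K₅) with hK
  have hK0 : K₀ ≤ K := ((le_max_left _ _).trans (le_max_left _ _)).trans (le_max_left _ _)
  have hK1 : K₁ ≤ K := ((le_max_right _ _).trans (le_max_left _ _)).trans (le_max_left _ _)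
  have hK2 : K₂ ≤ K := ((le_max_left _ _).trans (le_max_right _ _)).trans (le_max_left _ _)
  have hK3 : K₃ ≤ K := ((le_max_right _ _).trans (le_max_right _ _)).trans (le_max_left _ _)
  have hK4 : K₄ ≤ K := (le_max_left _ _).trans (le_max_right _ _)
  have hK5 : K₅ ≤ K := (le_max_right _ _).trans (le_max_right _ _)
  have hKpos : 0 < K := hK₀.trans_le hK0
  refine ⟨K ^ 3, by positivity, ?_⟩
  intro L _ s hs hsL z i j k μ₀
  set T : ℝ := max 1 s with hT
  have hT1 : 1 ≤ T := le_max_left _ _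
  have hT0 : 0 < T := by positivity
  set σ : ℝ := T ^ (-(1 / 2 : ℝ)) with hσ
  have hσ0 : 0 < σ := Real.rpow_pos_of_pos hT0 _
  have hσσ : σ * σ = T⁻¹ := max_one_rpow_neg_half_mul_self s
  have hσ2 : σ ^ 2 = T⁻¹ := by rw [sq, hσσ]
  have hσ3 : σ ^ 3 = T⁻¹ * σ := by rw [pow_succ, hσ2]
  have hσ4 : σ ^ 4 = T⁻¹ * T⁻¹ := by rw [show σ ^ 4 = σ ^ 2 * σ ^ 2 by ring, hσ2]
  -- the Gaussian weight
  set W : ZMod L → ℝ := fun m => ((1 + (m.valMinAbs : ℝ) ^ 2 / T) ^ 3)⁻¹ with hW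
  have hW0 : ∀ m, 0 ≤ W m := fun m => by positivity
  have hW1 : ∀ m, W m ≤ 1 := fun m => by
    rw [hW]
    exact inv_le_one_of_one_le₀ (one_le_pow₀ (by
      have : 0 ≤ (m.valMinAbs : ℝ) ^ 2 / T := by positivity
      linarith))
  -- the one-dimensional bounds with the common constant `K`
  have b₀ : ∀ m : ZMod L, |torusHeatKernel s m| ≤ K * σ * W m := fun m =>
    (h₀ L s hs hsL m).trans (by gcongr)
  have b₁ : ∀ m : ZMod L, |torusHeatKernel s (m + 1) - torusHeatKernel s m| ≤
      K * σ ^ 2 * W m := fun m => by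
    rw [hσ2]; exact (h₁ L s hs hsL m).trans (by gcongr)
  have b₂ : ∀ m : ZMod L, |torusHeatKernel s m - torusHeatKernel s (m - 1)| ≤
      K * σ ^ 2 * W m := fun m => by
    rw [hσ2]; exact (h₂ L s hs hsL m).trans (by gcongr)
  have b₃ : ∀ m : ZMod L, |torusHeatKernel s (m + 1) - 2 * torusHeatKernel s m +
      torusHeatKernel s (m - 1)| ≤ K * σ ^ 3 * W m := fun m => by
    rw [hσ3]; exact (h₃ L s hs hsL m).trans (by gcongr)
  have b₄ : ∀ m : ZMod L, |torusHeatKernel s m - 2 * torusHeatKernel s (m - 1) +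
      torusHeatKernel s (m - 2)| ≤ K * σ ^ 3 * W m := fun m => by
    rw [hσ3]; exact (h₄ L s hs hsL m).trans (by gcongr)
  have b₅ : ∀ m : ZMod L, |torusHeatKernel s (m + 1) - 3 * torusHeatKernel s m +
      3 * torusHeatKernel s (m - 1) - torusHeatKernel s (m - 2)| ≤ K * σ ^ 4 * W m := fun m => by
    rw [hσ4]; exact (h₅ L s hs hsL m).trans (by gcongr)
  -- the coordinate kernels `Q` and their amplitudes `a`
  obtain ⟨Q, hQ⟩ : ∃ Q : Fin 3 → ZMod L → ℝ, Q = fun μ m =>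
      if μ = k then torusHeatKernel s m - torusHeatKernel s (m - 1) else torusHeatKernel s m :=
    ⟨_, rfl⟩
  obtain ⟨a, ha⟩ : ∃ a : Fin 3 → ℝ, a = fun μ => if μ = k then K * σ else K := ⟨_, rfl⟩
  have hQk : ∀ m, Q k m = torusHeatKernel s m - torusHeatKernel s (m - 1) := fun m => by
    simp [hQ]
  have hQne : ∀ μ, μ ≠ k → ∀ m, Q μ m = torusHeatKernel s m := fun μ hμ m => by simp [hQ, hμ]
  have hak : a k = K * σ := by simp [ha]
  have hane : ∀ μ, μ ≠ k → a μ = K := fun μ hμ => by simp [ha, hμ]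
  have ha0 : ∀ μ, 0 ≤ a μ := fun μ => by
    by_cases hμ : μ = k
    · rw [hμ, hak]; positivity
    · rw [hane μ hμ]; positivity
  have H0 : ∀ μ m, |Q μ m| ≤ a μ * σ * W m := by
    intro μ m
    by_cases hμ : μ = k
    · rw [hμ, hQk, hak]
      calc _ ≤ K * σ ^ 2 * W m := b₂ m
        _ = K * σ * σ * W m := by ring
    · rw [hQne μ hμ, hane μ hμ]; exact b₀ m
  have H1 : ∀ μ m, |Q μ (m + 1) - Q μ m| ≤ a μ * σ ^ 2 * W m := by
    intro μ m
    by_cases hμ : μ = k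
    · rw [hμ, hQk, hQk, hak, add_sub_cancel_right,
        show torusHeatKernel s (m + 1) - torusHeatKernel s m -
          (torusHeatKernel s m - torusHeatKernel s (m - 1)) =
          torusHeatKernel s (m + 1) - 2 * torusHeatKernel s m + torusHeatKernel s (m - 1) by ring]
      calc _ ≤ K * σ ^ 3 * W m := b₃ m
        _ = K * σ * σ ^ 2 * W m := by ring
    · rw [hQne μ hμ, hQne μ hμ, hane μ hμ]; exact b₁ m
  have H2 : ∀ μ m, |Q μ m - Q μ (m - 1)| ≤ a μ * σ ^ 2 * W m := by
    intro μ m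
    by_cases hμ : μ = k
    · rw [hμ, hQk, hQk, hak, show (m - 1 - 1 : ZMod L) = m - 2 by ring,
        show torusHeatKernel s m - torusHeatKernel s (m - 1) -
          (torusHeatKernel s (m - 1) - torusHeatKernel s (m - 2)) =
          torusHeatKernel s m - 2 * torusHeatKernel s (m - 1) + torusHeatKernel s (m - 2) by ring]
      calc _ ≤ K * σ ^ 3 * W m := b₄ m
        _ = K * σ * σ ^ 2 * W m := by ring
    · rw [hQne μ hμ, hQne μ hμ, hane μ hμ]; exact b₂ m
  have H3 : ∀ μ m, |Q μ (m + 1) - 2 * Q μ m + Q μ (m - 1)| ≤ a μ * σ ^ 3 * W m := by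
    intro μ m
    by_cases hμ : μ = k
    · rw [hμ, hQk, hQk, hQk, hak, add_sub_cancel_right, show (m - 1 - 1 : ZMod L) = m - 2 by ring,
        show torusHeatKernel s (m + 1) - torusHeatKernel s m -
          2 * (torusHeatKernel s m - torusHeatKernel s (m - 1)) +
          (torusHeatKernel s (m - 1) - torusHeatKernel s (m - 2)) =
          torusHeatKernel s (m + 1) - 3 * torusHeatKernel s m + 3 * torusHeatKernel s (m - 1) -
            torusHeatKernel s (m - 2) by ring]
      calc _ ≤ K * σ ^ 4 * W m := b₅ m
        _ = K * σ * σ ^ 3 * W m := by ring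
    · rw [hQne μ hμ, hQne μ hμ, hQne μ hμ, hane μ hμ]; exact b₃ m
  -- assemble
  rw [thirdDiff_prod_eq (torusHeatKernel s) Q k hQk hQne z i j]
  have hmain := abs_hessian_prodKernel_le_fin Q a σ W ha0 hσ0.le hW0 hW1 H0 H1 H2 H3 z i j μ₀
  have hpa : ∏ μ, a μ = K ^ 3 * σ := by
    rw [← Finset.mul_prod_erase _ a (Finset.mem_univ k), hak]
    have : ∏ μ ∈ (univ : Finset (Fin 3)).erase k, a μ = ∏ _μ ∈ (univ : Finset (Fin 3)).erase k, K :=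
      Finset.prod_congr rfl fun μ hμ => hane μ (Finset.ne_of_mem_erase hμ)
    rw [this, Finset.prod_const, Finset.card_erase_of_mem (Finset.mem_univ k), Finset.card_univ,
      Fintype.card_fin]
    ring
  have hTm : T + ((z μ₀).valMinAbs : ℝ) ^ 2 ≠ 0 := by positivity
  have htarget : σ ^ 6 * W (z μ₀) = ((T + ((z μ₀).valMinAbs : ℝ) ^ 2) ^ 3)⁻¹ := by
    rw [show σ ^ 6 = σ ^ 2 * σ ^ 2 * σ ^ 2 by ring, hσ2, hW]
    field_simp
  calc _ ≤ (∏ μ, a μ) * σ ^ (3 + 2) * W (z μ₀) := hmain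
    _ = K ^ 3 * (σ ^ 6 * W (z μ₀)) := by rw [hpa]; ring
    _ = K ^ 3 * ((T + ((z μ₀).valMinAbs : ℝ) ^ 2) ^ 3)⁻¹ := by rw [htarget]

/-! ## §2 The `s`-weighted time integrals -/

/-- Pointwise: `s·(((1∨s) + M²)³)⁻¹ ≤ ((s + M²)²)⁻¹` for `s ≥ 0`, `M > 0` (`s ≤ (1∨s) + M²` and `s + M² ≤ (1∨s) + M²`). [folklore] -/
theorem mul_inv_cube_le_inv_sq {s M : ℝ} (hs : 0 ≤ s) (hM : 0 < M) :
    s * ((max 1 s + M ^ 2) ^ 3)⁻¹ ≤ ((s + M ^ 2) ^ 2)⁻¹ := by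
  set T : ℝ := max 1 s with hT
  have hsT : s ≤ T := le_max_right _ _
  have hu0 : 0 < s + M ^ 2 := by positivity
  have hv0 : 0 < T + M ^ 2 := by positivity
  have huv : s + M ^ 2 ≤ T + M ^ 2 := by linarith
  calc s * ((T + M ^ 2) ^ 3)⁻¹ ≤ (T + M ^ 2) * ((T + M ^ 2) ^ 3)⁻¹ := by
        gcongr; nlinarith
    _ = ((T + M ^ 2) ^ 2)⁻¹ := by field_simp
    _ ≤ ((s + M ^ 2) ^ 2)⁻¹ := by
        gcongr

/-- ★ **`∫₀^S s·(((1∨s) + M²)³)⁻¹ ds ≤ (M²)⁻¹`** for `M > 0`, `S ≥ 0` — the time integral behind `|∇³G̃₂(z)|·dist² ≤ C` (weight `s` from `1∕ε² = ∫₀^∞ s·e^{−sε}ds`,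
kernel bound `((1∨s) + M²)⁻³` from `abs_thirdDiff_hessian_prod_torusHeatKernel_le_three`). [folklore] -/
theorem integral_mul_inv_cube_le {M S : ℝ} (hM : 0 < M) (hS : 0 ≤ S) :
    ∫ s in (0 : ℝ)..S, s * ((max 1 s + M ^ 2) ^ 3)⁻¹ ≤ (M ^ 2)⁻¹ := by
  have hM2 : 0 < M ^ 2 := by positivity
  have hcont₁ : Continuous fun s : ℝ => s * ((max 1 s + M ^ 2) ^ 3)⁻¹ := by
    refine continuous_id.mul ((((continuous_const.max continuous_id).add continuous_const).pow 3).inv₀ ?_)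
    intro s
    show (max 1 s + M ^ 2) ^ 3 ≠ 0
    have h1 : 0 < max 1 s := lt_of_lt_of_le one_pos (le_max_left _ _)
    positivity
  have hcont₂ : ContinuousOn (fun s : ℝ => ((s + M ^ 2) ^ 2)⁻¹) (Set.uIcc 0 S) := by
    refine ContinuousOn.inv₀ (by fun_prop) ?_
    intro s hs'
    rw [Set.uIcc_of_le hS] at hs'
    have : 0 < s + M ^ 2 := by linarith [hs'.1]
    positivity
  calc ∫ s in (0 : ℝ)..S, s * ((max 1 s + M ^ 2) ^ 3)⁻¹
      ≤ ∫ s in (0 : ℝ)..S, ((s + M ^ 2) ^ 2)⁻¹ := by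
        refine intervalIntegral.integral_mono_on hS (hcont₁.intervalIntegrable _ _) (hcont₂.intervalIntegrable) ?_
        intro s hs'
        exact mul_inv_cube_le_inv_sq hs'.1 hM
    _ ≤ (M ^ 2)⁻¹ := integral_inv_add_sq_le hM2 hS

/-- Pointwise: `s·√(1∨s)·(((1∨s) + M²)³)⁻¹ ≤ (s + M²)^{−3∕2}` for `s ≥ 0`, `M > 0` (`s√T ≤ (T + M²)√(T + M²)` and `s + M² ≤ T + M²`, `T = 1∨s`). [folklore] -/
theorem mul_sqrt_mul_inv_cube_le_rpow {s M : ℝ} (hs : 0 ≤ s) (hM : 0 < M) :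
    s * Real.sqrt (max 1 s) * ((max 1 s + M ^ 2) ^ 3)⁻¹ ≤ (s + M ^ 2) ^ (-(3 / 2 : ℝ)) := by
  set T : ℝ := max 1 s with hT
  have hsT : s ≤ T := le_max_right _ _
  have hT0 : 0 ≤ T := hs.trans hsT
  have hu0 : 0 < s + M ^ 2 := by positivity
  have hv0 : 0 < T + M ^ 2 := by positivity
  have huv : s + M ^ 2 ≤ T + M ^ 2 := by linarith
  set v : ℝ := Real.sqrt (T + M ^ 2) with hv
  set w : ℝ := Real.sqrt (s + M ^ 2) with hw
  have hv2 : v ^ 2 = T + M ^ 2 := Real.sq_sqrt hv0.le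
  have hw2 : w ^ 2 = s + M ^ 2 := Real.sq_sqrt hu0.le
  have hw0 : 0 < w := Real.sqrt_pos.2 hu0
  have hvpos : 0 < v := Real.sqrt_pos.2 hv0
  have hwv : w ≤ v := Real.sqrt_le_sqrt huv
  have hTv : Real.sqrt T ≤ v := Real.sqrt_le_sqrt (le_add_of_nonneg_right (sq_nonneg M))
  -- the right-hand side is `(w ^ 3)⁻¹`
  have hw3 : w ^ 3 = (s + M ^ 2) ^ (3 / 2 : ℝ) := by
    rw [hw, Real.sqrt_eq_rpow, ← Real.rpow_natCast, ← Real.rpow_mul hu0.le]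
    norm_num
  have hrhs : (s + M ^ 2) ^ (-(3 / 2 : ℝ)) = (w ^ 3)⁻¹ := by
    rw [Real.rpow_neg hu0.le, hw3]
  rw [hrhs]
  -- `s√T ≤ v³`
  have hnum : s * Real.sqrt T ≤ v ^ 2 * v := by
    rw [hv2]
    exact mul_le_mul (hsT.trans (le_add_of_nonneg_right (sq_nonneg M))) hTv (Real.sqrt_nonneg _) hv0.le
  calc s * Real.sqrt T * ((T + M ^ 2) ^ 3)⁻¹ = s * Real.sqrt T * ((v ^ 2) ^ 3)⁻¹ := by rw [hv2]
    _ ≤ v ^ 2 * v * ((v ^ 2) ^ 3)⁻¹ := by gcongr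
    _ = (v ^ 3)⁻¹ := by field_simp
    _ ≤ (w ^ 3)⁻¹ := by
        gcongr

/-- `∫₀^S (s + M²)^{−3∕2} ds ≤ 2∕M` for `M > 0`, `S ≥ 0` (`= 2∕M − 2∕√(S + M²)`). [folklore] -/
theorem integral_rpow_neg_three_halves_le {M S : ℝ} (hM : 0 < M) (hS : 0 ≤ S) :
    ∫ s in (0 : ℝ)..S, (s + M ^ 2) ^ (-(3 / 2 : ℝ)) ≤ 2 / M := by
  have hM2 : 0 < M ^ 2 := by positivity
  rw [intervalIntegral.integral_comp_add_right (fun u : ℝ => u ^ (-(3 / 2 : ℝ))) (M ^ 2), zero_add]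
  have h0 : (0 : ℝ) ∉ Set.uIcc (M ^ 2) (S + M ^ 2) := by
    rw [Set.uIcc_of_le (by linarith)]
    intro h
    exact absurd h.1 (not_le.2 hM2)
  rw [integral_rpow (Or.inr ⟨by norm_num, h0⟩)]
  have e1 : (-(3 / 2 : ℝ)) + 1 = -(1 / 2 : ℝ) := by norm_num
  rw [e1]
  have hA : (M ^ 2) ^ (-(1 / 2 : ℝ)) = M⁻¹ := by
    rw [Real.rpow_neg hM2.le, ← Real.sqrt_eq_rpow, Real.sqrt_sq hM.le]
  have hB : 0 ≤ (S + M ^ 2) ^ (-(1 / 2 : ℝ)) := Real.rpow_nonneg (by linarith) _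
  rw [hA]
  have : ((S + M ^ 2) ^ (-(1 / 2 : ℝ)) - M⁻¹) / -(1 / 2 : ℝ) = 2 / M - 2 * (S + M ^ 2) ^ (-(1 / 2 : ℝ)) := by
    field_simp
    ring
  rw [this]
  linarith

/-- ★ **`∫₀^S s·√(1∨s)·(((1∨s) + M²)³)⁻¹ ds ≤ 2∕M`** for `M > 0`, `S ≥ 0` — the time integral behind `|∇ᵢ⁺∇ⱼ⁻G̃₂(z)|·dist ≤ C` (weight `s`, Hessian kernel bound
`√(1∨s)·((1∨s) + M²)⁻³` of ✓ `Prop7TorusGreenHessianDecay.abs_hessian_prod_torusHeatKernel_le_three`).  The AM–GM step `√T(T+M²)⁻³ ≤ (2M)⁻¹(T+M²)⁻²` of the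
unweighted Hessian integral would give `∫₀^{L²}(s+M²)⁻¹ds = log(1 + L²∕M²)` here; the `3∕2`-power is needed. [folklore] -/
theorem integral_mul_sqrt_mul_inv_cube_le {M S : ℝ} (hM : 0 < M) (hS : 0 ≤ S) :
    ∫ s in (0 : ℝ)..S, s * Real.sqrt (max 1 s) * ((max 1 s + M ^ 2) ^ 3)⁻¹ ≤ 2 / M := by
  have hcont₁ : Continuous fun s : ℝ => s * Real.sqrt (max 1 s) * ((max 1 s + M ^ 2) ^ 3)⁻¹ := by
    refine (continuous_id.mul ((continuous_const.max continuous_id).sqrt)).mul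
      ((((continuous_const.max continuous_id).add continuous_const).pow 3).inv₀ ?_)
    intro s
    show (max 1 s + M ^ 2) ^ 3 ≠ 0
    have h1 : 0 < max 1 s := lt_of_lt_of_le one_pos (le_max_left _ _)
    positivity
  have hcont₂ : ContinuousOn (fun s : ℝ => (s + M ^ 2) ^ (-(3 / 2 : ℝ))) (Set.uIcc 0 S) := by
    refine ContinuousOn.rpow_const (by fun_prop) ?_
    intro s hs'
    rw [Set.uIcc_of_le hS] at hs'
    left
    have : 0 < s + M ^ 2 := by have := hs'.1; positivity
    exact this.ne'
  calc ∫ s in (0 : ℝ)..S, s * Real.sqrt (max 1 s) * ((max 1 s + M ^ 2) ^ 3)⁻¹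
      ≤ ∫ s in (0 : ℝ)..S, (s + M ^ 2) ^ (-(3 / 2 : ℝ)) := by
        refine intervalIntegral.integral_mono_on hS (hcont₁.intervalIntegrable _ _) (hcont₂.intervalIntegrable) ?_
        intro s hs'
        exact mul_sqrt_mul_inv_cube_le_rpow hs'.1 hM
    _ ≤ 2 / M := integral_rpow_neg_three_halves_le hM hS

end Summit.QuantumFields.YangMills.Theorems.Prop7TorusHeatKernelThirdDiffThree

end
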